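import Summits.RiemannHypothesis.RiemannHypothesis.Theorems.TiltedLandingLaw421R3SinkBdry
import Summits.RiemannHypothesis.RiemannHypothesis.Theorems.TiltedLandingLaw421R3SinkCornerReduction

/-!
# «SinkEndsKink» v2 — the RIGHT-SIDED corner conjectures of 113 «CornerReduction» (#1266: `CornerDominanceRSig`, `…EndsRSig`, `…KinkRSig`, binder
`xv ≤ Re w`) AS STATEMENTS ABOUT THE REAL RATIONAL FUNCTIONS of 110 «SinkBdry» (#1261) (C1 desk, rh-idea-5: cut g39, image g40; files-only; SUPPORT, K only;
consumer named by director-rh (CA1009)(3)/(CA1015)(1): the «Ends ∧ Kink ⇒ C′» side of «Ends ∧ Kink ⇒ C′ ⇒ lcert bound ⇒ `CertificatesExistRightSig`»,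
rule by rule in the coordinates where C3's exact certificates live)

v2 vs v1 (9c596cc7): re-targeted to 113's R-sided names with the side condition `xv ≤ w.re` ⇝ `0 ≤ δ` in coordinates (the unsided forms are false for
left children — `RhW08.SinkMirrorNeg.not_cornerDominanceSig`, #1267); decls byte-identical to the g39 drawer 32b41524.  TWO imports, both TREE, siblings
over 102: 110 «SinkBdry» (#1261) and 113 «CornerReduction» (#1266).  Namespace `RhW08.SinkEndsKink`; nothing of 102 / 110 / 113 re-declared.  (K) only:
`cornerRatio_realTwoPoint`, the kink condition `KinkWeight ↔ KinkWeightForm R δ t h y0`, the right-sided real forms `CornerDominanceRRealSig` /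
`CornerDominanceEndsRRealSig` / `CornerDominanceKinkRRealSig` (110's binders + `0 ≤ δ`) with ★`cornerDominanceRSig_iff`, ★`cornerDominanceEndsRSig_iff`,
★`cornerDominanceKinkRSig_iff`, and the corollary `cornerDominanceRSig_iff_endsReal_and_kinkReal` — so the repaired conjecture is, rule by rule, three
statements about `twoPointNForm` / `pairCForm` on the four boundary pieces at `δ ≥ 0`.
LEVEL: SUPPORT (K).  Asserts no law.  No `sorry`.  Nothing here bears on the truth of RH; RH is not proved; ⟨33346⟩/⟨33347⟩ OPEN; the three R-conjectures
and `CertificatesExistSig` OPEN; checked ≠ keyed ≠ landed ≠ proved.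
-/

noncomputable section

open Complex
open scoped ComplexConjugate
open RhW08.SinkTemplate RhW08.SinkBdry RhW08.SinkCornerReduction

namespace RhW08.SinkEndsKink

/-! ## §1 The corner ratio and the kink condition in coordinates -/

/-- the ratio `N(z)/c(z)` of `realTwoPoint xv h y0 w` at `z = xv + ξ + i·b`, in coordinates `δ = Re w − xv`, `t = Im w`. -/
theorem cornerRatio_realTwoPoint (xv h y0 : ℝ) (w : ℂ) (ξ b : ℝ) :
    cornerRatio (realTwoPoint xv h y0 w) w ⟨xv + ξ, b⟩ = twoPointNForm (w.re - xv) w.im h y0 ξ b / pairCForm (w.re - xv) w.im ξ b := by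
  unfold cornerRatio
  simp only [cutNumer_realTwoPoint, farPairC_eq w _ xv, add_sub_cancel_left]

/-- THE KINK CONDITION IN COORDINATES: the two top-corner ratios of the real two-point family agree (window `R`, child `(δ, t)`, box top `h`, weight `y0`). -/
def KinkWeightForm (R δ t h y0 : ℝ) : Prop :=
  twoPointNForm δ t h y0 (R / 2) (R / 2) / pairCForm δ t (R / 2) (R / 2) =
    twoPointNForm δ t h y0 (-(R / 2)) (R / 2) / pairCForm δ t (-(R / 2)) (R / 2)

/-- 113's `KinkWeight` ↔ `KinkWeightForm R (Re w − xv) (Im w) h y0`. -/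
theorem kinkWeight_iff_form (xv R h y0 : ℝ) (w : ℂ) : KinkWeight xv R h y0 w ↔ KinkWeightForm R (w.re - xv) w.im h y0 := by
  unfold KinkWeight KinkWeightForm
  rw [show (⟨xv - R / 2, R / 2⟩ : ℂ) = ⟨xv + -(R / 2), R / 2⟩ by simp [sub_eq_add_neg], cornerRatio_realTwoPoint, cornerRatio_realTwoPoint]

/-! ## §2 The right-sided conjectures in real closed form -/

/-- RIGHT-SIDED CORNER DOMINANCE AS A STATEMENT ABOUT REAL RATIONAL FUNCTIONS (equivalent to 113's `CornerDominanceRSig` by `cornerDominanceRSig_iff`;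
a CONJECTURE, not proved here): 110's `CornerDominanceRealSig` with the extra binder `0 ≤ δ` (child right of, or on, the axis). -/
def CornerDominanceRRealSig : Prop :=
  ∀ (R s h y0 δ t Y : ℝ),
    0 < s → 6 * s ≤ R → 3 * h < R → 0 < Y → Y ≤ h →
    0 < t → t < Y → Y - s / 4 < t → δ ^ 2 + t ^ 2 ≤ Y ^ 2 →
    |δ| * (R - |δ|) < t ^ 2 → 0 ≤ δ → 0 ≤ y0 → y0 ≤ 1 →
    BdryDomForm R δ t h y0 (cornerSigmaForm R δ t h y0)

/-- RIGHT-SIDED CORNER DOMINANCE AT THE END WEIGHTS `y0 ∈ {0, 1}` in real closed form (equivalent to 113's `CornerDominanceEndsRSig`; a CONJECTURE;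
the `y0 = 1` conjunct is `h`-free). -/
def CornerDominanceEndsRRealSig : Prop :=
  ∀ (R s h δ t Y : ℝ),
    0 < s → 6 * s ≤ R → 3 * h < R → 0 < Y → Y ≤ h →
    0 < t → t < Y → Y - s / 4 < t → δ ^ 2 + t ^ 2 ≤ Y ^ 2 →
    |δ| * (R - |δ|) < t ^ 2 → 0 ≤ δ →
    BdryDomForm R δ t h 0 (cornerSigmaForm R δ t h 0) ∧ BdryDomForm R δ t h 1 (cornerSigmaForm R δ t h 1)

/-- RIGHT-SIDED CORNER DOMINANCE AT THE KINK WEIGHT in real closed form (equivalent to 113's `CornerDominanceKinkRSig`; a CONJECTURE). -/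
def CornerDominanceKinkRRealSig : Prop :=
  ∀ (R s h y0 δ t Y : ℝ),
    0 < s → 6 * s ≤ R → 3 * h < R → 0 < Y → Y ≤ h →
    0 < t → t < Y → Y - s / 4 < t → δ ^ 2 + t ^ 2 ≤ Y ^ 2 →
    |δ| * (R - |δ|) < t ^ 2 → 0 ≤ δ → 0 < y0 → y0 < 1 → KinkWeightForm R δ t h y0 →
    BdryDomForm R δ t h y0 (cornerSigmaForm R δ t h y0)

/-- 113's `CornerDominanceRSig` ↔ its real closed form. -/
theorem cornerDominanceRSig_iff : CornerDominanceRSig ↔ CornerDominanceRRealSig := by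
  constructor
  · intro hC R s h y0 δ t Y hs hR6 h3 hY hYh ht htY hdrop hnest hcone hδ hy0 hy1
    have hR : 0 ≤ R := by linarith
    have hK := hC 0 R s h y0 ⟨0, Y⟩ ⟨δ, t⟩ hs hR6 h3 rfl hY hYh ht htY hdrop (by simpa using hnest)
      (by simpa [ConeChild] using hcone) (by simpa using hδ) hy0 hy1
    rw [kernelDomBdry_realTwoPoint_iff 0 R h y0 hR, cornerSigma_realTwoPoint] at hK
    simpa using hK
  · intro hReal xv R s h y0 v w hs hR6 h3 _hv hY hYh ht htY hdrop hnest hcone hδ hy0 hy1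
    have hR : 0 ≤ R := by linarith
    rw [kernelDomBdry_realTwoPoint_iff xv R h y0 hR, cornerSigma_realTwoPoint]
    exact hReal R s h y0 (w.re - xv) w.im v.im hs hR6 h3 hY hYh ht htY hdrop hnest hcone (sub_nonneg.2 hδ) hy0 hy1

/-- 113's `CornerDominanceEndsRSig` ↔ its real closed form. -/
theorem cornerDominanceEndsRSig_iff : CornerDominanceEndsRSig ↔ CornerDominanceEndsRRealSig := by
  constructor
  · intro hC R s h δ t Y hs hR6 h3 hY hYh ht htY hdrop hnest hcone hδ
    have hR : 0 ≤ R := by linarith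
    have hK := hC 0 R s h ⟨0, Y⟩ ⟨δ, t⟩ hs hR6 h3 rfl hY hYh ht htY hdrop (by simpa using hnest)
      (by simpa [ConeChild] using hcone) (by simpa using hδ)
    rw [kernelDomBdry_realTwoPoint_iff 0 R h 0 hR, kernelDomBdry_realTwoPoint_iff 0 R h 1 hR, cornerSigma_realTwoPoint,
      cornerSigma_realTwoPoint] at hK
    simpa using hK
  · intro hReal xv R s h v w hs hR6 h3 _hv hY hYh ht htY hdrop hnest hcone hδ
    have hR : 0 ≤ R := by linarith
    rw [kernelDomBdry_realTwoPoint_iff xv R h 0 hR, kernelDomBdry_realTwoPoint_iff xv R h 1 hR, cornerSigma_realTwoPoint,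
      cornerSigma_realTwoPoint]
    exact hReal R s h (w.re - xv) w.im v.im hs hR6 h3 hY hYh ht htY hdrop hnest hcone (sub_nonneg.2 hδ)

/-- 113's `CornerDominanceKinkRSig` ↔ its real closed form. -/
theorem cornerDominanceKinkRSig_iff : CornerDominanceKinkRSig ↔ CornerDominanceKinkRRealSig := by
  constructor
  · intro hC R s h y0 δ t Y hs hR6 h3 hY hYh ht htY hdrop hnest hcone hδ hy0 hy1 hkink
    have hR : 0 ≤ R := by linarith
    have hK := hC 0 R s h y0 ⟨0, Y⟩ ⟨δ, t⟩ hs hR6 h3 rfl hY hYh ht htY hdrop (by simpa using hnest)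
      (by simpa [ConeChild] using hcone) (by simpa using hδ) hy0 hy1 (by simpa [kinkWeight_iff_form] using hkink)
    rw [kernelDomBdry_realTwoPoint_iff 0 R h y0 hR, cornerSigma_realTwoPoint] at hK
    simpa using hK
  · intro hReal xv R s h y0 v w hs hR6 h3 _hv hY hYh ht htY hdrop hnest hcone hδ hy0 hy1 hkink
    have hR : 0 ≤ R := by linarith
    rw [kernelDomBdry_realTwoPoint_iff xv R h y0 hR, cornerSigma_realTwoPoint]
    exact hReal R s h y0 (w.re - xv) w.im v.im hs hR6 h3 hY hYh ht htY hdrop hnest hcone (sub_nonneg.2 hδ) hy0 hy1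
      ((kinkWeight_iff_form xv R h y0 w).1 hkink)

/-- COROLLARY (K): the repaired corner conjecture is the conjunction of the two right-sided real closed forms. -/
theorem cornerDominanceRSig_iff_endsReal_and_kinkReal :
    CornerDominanceRSig ↔ CornerDominanceEndsRRealSig ∧ CornerDominanceKinkRRealSig := by
  rw [cornerDominanceRSig_iff_ends_and_kink, cornerDominanceEndsRSig_iff, cornerDominanceKinkRSig_iff]

end RhW08.SinkEndsKink

end
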